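import Mathlib.Analysis.InnerProductSpace.PiL2
import Mathlib.Analysis.SpecialFunctions.Pow.Real
import HarnessLib

/-!
# The kissing number in dimension four is `24` (Musin 2008) and the `24`-point configuration is
# unique: the `D₄` root shell (de Laat–Leijenhorst–de Muinck Keizer 2024)

Topic `Literature/Geometry/DiscreteGeometry`; TWO named facts (results in print, `def … : Prop`,
D-0014) requested by `wi-16255` for route `AtomisticToContinuum/SlackFreeD4` (crux
`KissingFourClassification`, whose two conjuncts these facts are meant to supply as hypotheses).

A *kissing configuration* in `ℝⁿ` is a set of non-overlapping unit spheres touching a central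
unit sphere; it is identified with the set `C ⊆ 𝕊^{n−1}` of contact points (unit vectors), whose
pairwise angles are `≥ π/3`, i.e. `⟨x, y⟩ ≤ 1/2` for distinct `x, y ∈ C` (equivalently
`‖x − y‖ ≥ 1`, `dist_sq_eq_two_sub_two_inner` below); `k(n)` is the maximal size
(DLLdMK 2024, §1; Musin 2008, §1–2: spherical `π/3`-codes).

* **Musin 2008** (Ann. of Math. 168, arXiv:math/0309430, read §2): **Main Theorem. `k(4) = 24`.**
  ("Let `X` be a spherical `π/3`-code in `𝕊³` with `M = k(4)` points … `M ≤ 24`"; the lower bound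
  is the `24`-cell.) Vendored as the upper bound: every finite set of unit vectors of `ℝ⁴` with
  pairwise inner products `≤ 1/2` has at most `24` elements — `musin2008_kissing_four`.
* **de Laat–Leijenhorst–de Muinck Keizer 2024** (arXiv:2404.18794, read §1 and §5.1):
  the `D₄` root system = "all `24` vectors in `ℝ⁴` with integer coordinates and length `√2`",
  normalised to unit length; **Lemma 5.1**: "If `C ⊆ 𝕊³` is a subset of size `24` with minimal
  angle at least `π/3`, then `⟨x, y⟩ ∈ {−1, −1/2, 0, 1/2}` for all distinct `x, y ∈ C`" (exact
  rational second-level Lasserre certificate, verified in ball arithmetic, data public);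
  **Theorem 5.3**: "The `D₄` root system is the unique optimal kissing configuration in `ℝ⁴` up to
  isometry" (proof: `C` is a root system; classification — or the Calderbank et al. alternative;
  "Hence `C` is `D₄` up to orthogonal transformations"). Vendored: Theorem 5.3 combined with
  `k(4) = 24` ("optimal" = of size `24`; Lemma 5.1 is the rigidity step of its proof and follows
  back from it by inspecting `d4Roots`, so it is not vendored separately):
  every `24`-element kissing configuration of `ℝ⁴` is the image of the normalised `D₄` root shell
  `d4Roots` under a linear isometry of `ℝ⁴` (`dlldmk2024_kissing_four_unique`).

## Rendering

* `ℝ⁴ = EuclideanSpace ℝ (Fin 4)`; configurations are `Finset`s; "up to isometry" = up to an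
  orthogonal transformation, `EuclideanSpace ℝ (Fin 4) ≃ₗᵢ[ℝ] EuclideanSpace ℝ (Fin 4)` (the
  configuration lies on the unit sphere centred at the origin, as in the proof of Thm 5.3).
* `d4Roots = {z/√2 : z ∈ ℤ⁴, Σ z_k² = 2}` (the `24` vectors `(±1, ±1, 0, 0)/√2` and permutations;
  DLLdMK §1, Musin §1 "`(±√2, ±√2, 0, 0)`" at radius `2`). Proved API: its elements are unit
  vectors (`norm_eq_one_of_mem_d4Roots`); the distance/inner-product dictionary.
* Not vendored: Lemma 5.1 as a separate fact, Theorem 5.2 (`D₄` is an optimal spherical code), the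
  `k(4) ≥ 24` half (a computation on `d4Roots`, left to consumers), results in other dimensions.

## References

* O. R. Musin, *The kissing number in four dimensions*, Ann. of Math. 168 (2008) 1–32,
  arXiv:math/0309430: §2 Main Theorem (`k(4) = 24`), Lemmas A–B. [`Musin2008`]
* D. de Laat, N. Leijenhorst, W. H. H. de Muinck Keizer, *Optimality and uniqueness of the `D₄`
  root system*, arXiv:2404.18794 (2024): §1, §5.1 Lemma 5.1, Thm 5.2, Thm 5.3.
  [`DeLaatLeijenhorstDeMuinckKeizer2024`]
-/

noncomputable section

open scoped RealInnerProductSpace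

namespace Literature.Geometry.DiscreteGeometry

/-- Local notation for `ℝ⁴ = EuclideanSpace ℝ (Fin 4)`. -/
local notation "E⁴" => EuclideanSpace ℝ (Fin 4)

/-! ### The `D₄` root shell -/

/-- The **normalised `D₄` root system** (`24`-cell vertices on the unit sphere): the vectors
`z/√2` with `z ∈ ℤ⁴`, `Σ_k z_k² = 2`, i.e. `(±1, ±1, 0, 0)/√2` and coordinate permutations —
"all `24` vectors in `ℝ⁴` with integer coordinates and length `√2` … normalize[d] to have unit
length" (de Laat–Leijenhorst–de Muinck Keizer 2024, §1; Musin 2008 §1 at radius `2`).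
[cite: DeLaatLeijenhorstDeMuinckKeizer2024, §1 (the D₄ root system)] -/
def d4Roots : Set E⁴ :=
  {x | ∃ z : Fin 4 → ℤ, (∑ k, z k ^ 2 = 2) ∧ ∀ k, x k = (z k : ℝ) / Real.sqrt 2}

/-- Membership in `d4Roots`, unfolded. [folklore] -/
theorem mem_d4Roots_iff (x : E⁴) :
    x ∈ d4Roots ↔ ∃ z : Fin 4 → ℤ, (∑ k, z k ^ 2 = 2) ∧ ∀ k, x k = (z k : ℝ) / Real.sqrt 2 :=
  Iff.rfl

/-- The normalised `D₄` roots are unit vectors: `‖z/√2‖² = (Σ z_k²)/2 = 1`.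
[cite: DeLaatLeijenhorstDeMuinckKeizer2024, §1 (roots normalised to unit length)] -/
theorem norm_eq_one_of_mem_d4Roots {x : E⁴} (hx : x ∈ d4Roots) : ‖x‖ = 1 := by
  obtain ⟨z, hz, hxz⟩ := hx
  have hz' : (∑ k, ((z k : ℝ)) ^ 2) = 2 := by exact_mod_cast hz
  have h2 : ‖x‖ ^ 2 = 1 := by
    rw [EuclideanSpace.norm_eq, Real.sq_sqrt (Finset.sum_nonneg fun i _ => sq_nonneg _)]
    simp_rw [Real.norm_eq_abs, sq_abs, hxz, div_pow, Real.sq_sqrt (show (0 : ℝ) ≤ 2 by norm_num),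
      ← Finset.sum_div, hz']
    norm_num
  have h0 : 0 ≤ ‖x‖ := norm_nonneg x
  nlinarith [h2, h0]

/-! ### Kissing configurations: the dictionary between distance and inner product -/

/-- For unit vectors, `‖x − y‖² = 2 − 2⟨x, y⟩`. [folklore] -/
theorem dist_sq_eq_two_sub_two_inner {F : Type*} [NormedAddCommGroup F] [InnerProductSpace ℝ F]
    {x y : F} (hx : ‖x‖ = 1) (hy : ‖y‖ = 1) : dist x y ^ 2 = 2 - 2 * inner ℝ x y := by
  rw [dist_eq_norm, ← real_inner_self_eq_norm_sq, inner_sub_left, inner_sub_right, inner_sub_right,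
    real_inner_self_eq_norm_sq, real_inner_self_eq_norm_sq, hx, hy, real_inner_comm y x]
  ring

/-- For unit vectors, pairwise distance `≥ 1` (non-overlapping kissing spheres) is the same as
inner product `≤ 1/2` (angle `≥ π/3`). [folklore] -/
theorem one_le_dist_iff_inner_le_half {F : Type*} [NormedAddCommGroup F] [InnerProductSpace ℝ F]
    {x y : F} (hx : ‖x‖ = 1) (hy : ‖y‖ = 1) : 1 ≤ dist x y ↔ inner ℝ x y ≤ 1 / 2 := by
  have h := dist_sq_eq_two_sub_two_inner hx hy
  have hd : 0 ≤ dist x y := dist_nonneg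
  constructor
  · intro h1; nlinarith
  · intro h1
    by_contra hlt
    rw [not_le] at hlt
    nlinarith [mul_lt_mul'' hlt hlt hd hd]

/-! ### Musin 2008: `k(4) = 24` -/

/-- **Musin 2008, Main Theorem: `k(4) = 24`** — the upper bound. Every finite set `C` of unit
vectors of `ℝ⁴` whose distinct members have inner product `≤ 1/2` (angular separation `≥ π/3`,
a spherical `π/3`-code in `𝕊³`; equivalently pairwise Euclidean distance `≥ 1`,
`one_le_dist_iff_inner_le_half`) has at most `24` elements ("`M ≤ 24`", proof of the Main
Theorem, §2: Lemma A (`S(X) ≥ M²` for the degree-9 polynomial `f₄`) and Lemma B (`S(X) < 25M`)).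
Not proved here. [cite: Musin2008, §2 Main Theorem (k(4) = 24)] -/
def musin2008_kissing_four : Prop :=
  ∀ C : Finset E⁴, (∀ x ∈ C, ‖x‖ = 1) → (∀ x ∈ C, ∀ y ∈ C, x ≠ y → inner ℝ x y ≤ 1 / 2) →
    C.card ≤ 24

/-- Distance form of Musin's theorem (the shape used by route `SlackFreeD4`): unit vectors of `ℝ⁴`
pairwise at Euclidean distance `≥ 1` number at most `24`. PROVED from `musin2008_kissing_four`.
[cite: Musin2008, §2 Main Theorem (k(4) = 24)] -/
theorem musin2008_kissing_four.dist_form (h : musin2008_kissing_four) (C : Finset E⁴)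
    (hunit : ∀ x ∈ C, ‖x‖ = 1) (hsep : ∀ x ∈ C, ∀ y ∈ C, x ≠ y → 1 ≤ dist x y) : C.card ≤ 24 :=
  h C hunit fun x hx y hy hxy => (one_le_dist_iff_inner_le_half (hunit x hx) (hunit y hy)).1
    (hsep x hx y hy hxy)

/-! ### de Laat–Leijenhorst–de Muinck Keizer 2024: rigidity and uniqueness at `24` points -/

/-- **de Laat–Leijenhorst–de Muinck Keizer 2024, Theorem 5.3 (with Musin's `k(4) = 24`):
uniqueness of the optimal kissing configuration in `ℝ⁴`.** "The `D₄` root system is the unique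
optimal kissing configuration in `ℝ⁴` up to isometry"; since `k(4) = 24` (Musin 2008), "optimal"
means "of size `24`", so: every set of `24` unit vectors of `ℝ⁴` with pairwise inner products
`≤ 1/2` is the image of the normalised `D₄` root shell `d4Roots` under a linear isometry of `ℝ⁴`
(proof of Thm 5.3: "`C` is `D₄` up to orthogonal transformations"). Not proved here (`C` is a
root system by Lemma 5.1; classification of simply-laced root systems, or the alternative via
Calderbank et al.). [cite: DeLaatLeijenhorstDeMuinckKeizer2024, Theorem 5.3] -/
def dlldmk2024_kissing_four_unique : Prop :=
  ∀ C : Finset E⁴, C.card = 24 → (∀ x ∈ C, ‖x‖ = 1) →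
    (∀ x ∈ C, ∀ y ∈ C, x ≠ y → inner ℝ x y ≤ 1 / 2) →
      ∃ f : E⁴ ≃ₗᵢ[ℝ] E⁴, (C : Set E⁴) = f '' d4Roots

/-- Distance form of the uniqueness theorem (the shape used by route `SlackFreeD4`): `24` unit
vectors of `ℝ⁴` pairwise at distance `≥ 1` form an isometric image of `d4Roots`. PROVED from
`dlldmk2024_kissing_four_unique`. [cite: DeLaatLeijenhorstDeMuinckKeizer2024, Theorem 5.3] -/
theorem dlldmk2024_kissing_four_unique.dist_form (h : dlldmk2024_kissing_four_unique)
    (C : Finset E⁴) (hcard : C.card = 24) (hunit : ∀ x ∈ C, ‖x‖ = 1)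
    (hsep : ∀ x ∈ C, ∀ y ∈ C, x ≠ y → 1 ≤ dist x y) :
    ∃ f : E⁴ ≃ₗᵢ[ℝ] E⁴, (C : Set E⁴) = f '' d4Roots :=
  h C hcard hunit fun x hx y hy hxy =>
    (one_le_dist_iff_inner_le_half (hunit x hx) (hunit y hy)).1 (hsep x hx y hy hxy)

end Literature.Geometry.DiscreteGeometry

end
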